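import Summits.Ventures.DiscreteObjects.Hadamard.ConferenceGraph333PrimeOrder

/-!
# Prime-order spectrum of Aut(srg(333,166,82,83)) ⊆ {2,3,5,7,11,13,17,23,37,41,83}, with fixed-point windows (kernel)

Framing: lottery ticket; floor = certified bounds/negative ranges.  Cell pub-namedobj (venture DiscreteObjects),
target (H) = `H(668)`, hadamard gen 28.  THE PRIME-ORDER CENSUS of `srg(333,166,82,83)` ⇔ symmetric `C(334)`
(⇒ `H(668)`), parallel to the `H(668)` census of gens 5–18 (there: `{2,3,5,7,11,13,23,29,37,41,83,167}`).  Builds on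
`ConferenceGraph333PrimeOrder` (orbits of a prime-order permutation as finsets, the parity law for `p ≡ 3 (mod 4)`),
`ConferenceGraph333TwoCells` (class-sum identities) and `ClassSumTrace` (`tr R = 0`).
* **`primeOrder_census`** — `A` an `srg(333,166,82,83)`, `p` an odd prime, `σ ≠ 1` with `σ^p = 1` preserving
  adjacency, `f` fixed points: `∃ m ≥ 1` (the number of `p`-orbits) with `f + p·m = 333`, the ROW BOUND
  `p·f + m + p ≤ 334`, and for `p ≡ 3 (mod 4)`: `m` even and `p·f + m + p + 4 ≤ 334`.  The row bound is the class-sum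
  identity `Σ_j R_{ij}R_{ji} = 333 − p` at a `p`-orbit `i` rewritten with `n_i R_{ij} = n_j R_{ji}`: a fixed column
  contributes `p·S² = p`, another `p`-orbit an ODD (hence nonzero) sum of `p` signs squared `≥ 1`, the diagonal
  `R_{ii}² = 4u_i² ≥ 0` (`≥ 4` when `u_i` is odd, i.e. `p ≡ 3 (mod 4)`).
* **`aut_prime_spectrum`** — hence a non-identity automorphism of prime order `p` has
  **`p ∈ {2, 3, 5, 7, 11, 13, 17, 23, 37, 41, 83}`** (`interval_cases` + `omega` on the census inequalities; e.g. `19`: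
  `f ≡ 29 (mod 38)` but `f ≤ 15`; `29`: `f ≡ 14 (mod 29)` but `f ≤ 10`; `31, 43, 47, 53, 59, …, 331` likewise).
* **`aut_prime_windows`** — the surviving odd primes with their fixed-point windows:
  `3: f ≡ 3 (6), f ≤ 81` · `5: f ≡ 3 (5), f ≤ 53` · `7: f ∈ {11,25,39}` · `11: {3,25}` · `13: {8,21}` · `17: {10}` ·
  `23: {11}` · `37: {0}` · `41: {5}` · `83: {1}` (and `2`: `f ≡ 1 (mod 4)`, `ConferenceGraph333Involution`).
WORDS: structure of a HYPOTHETICAL object (no srg(333,166,82,83) / C(334) / H(668) is constructed or excluded); the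
`37: f = 0` line matches gen 27's orbit-matrix witness (`C334Orbit37Matrix`).  Method in print: orbit matrices of
strongly regular graphs with a prescribed automorphism (Behbahani–Lam 2011; Crnković–Maksimović–Rukavina–…);
the instance and the kernel proofs are ours (PROVISIONAL).  No `sorry`, no new definitions.
-/

namespace Summit.Ventures.DiscreteObjects.Hadamard

open Finset

/-- `333` is not a square (private copy; the public lemma lives in `ConferenceGraph333Order3`). -/
private theorem not_isSquare_333_sp : ¬ IsSquare (333 : ℕ) := by
  rintro ⟨r, hr⟩
  have : r ≤ 19 := by nlinarith
  interval_cases r <;> omega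

section spectrum
variable {V : Type*} [Fintype V] [DecidableEq V]

/-- **Prime-order census with the row bound.**  `A` the adjacency matrix of an `srg(333,166,82,83)`, `p` an ODD prime,
`σ ≠ 1` a permutation with `σ^p = 1` preserving adjacency, `f` its number of fixed points.  Then there is `m ≥ 1`
(the number of `p`-orbits) with `f + p·m = 333` and the ROW BOUND `p·f + m + p ≤ 334` (row identity of the class-sum
matrix at a `p`-orbit: `Σ_j (n_i/n_j) R_{ij}² = 333 − p`, fixed columns contribute `p` each, other `p`-orbits `≥ 1`
each); if moreover `p ≡ 3 (mod 4)` then `m` is even and the bound improves by `4` (`R_{ii} = 2u_i`, `u_i` odd). -/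
theorem primeOrder_census (hV : Fintype.card V = 333) (A : Matrix V V ℤ)
    (h01 : ∀ x y, A x y = 0 ∨ A x y = 1) (hsymm : ∀ x y, A y x = A x y) (hdiag : ∀ x, A x x = 0)
    (hk : ∀ x, ∑ y, A x y = 166) (hsrg : ∀ x y, ∑ z, A x z * A z y = 83 * (1 + (if x = y then 1 else 0)) - A x y)
    {p : ℕ} (hp : p.Prime) (hp2 : p ≠ 2) (σ : Equiv.Perm V) (hσ : σ ^ p = 1) (hσ1 : σ ≠ 1)
    (hA : ∀ x y, A (σ x) (σ y) = A x y) :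
    ∃ f m : ℕ, (univ.filter fun x => σ x = x).card = f ∧ f + p * m = 333 ∧ 1 ≤ m ∧ p * f + m + p ≤ 334 ∧
      (p % 4 = 3 → 2 ∣ m ∧ p * f + m + p + 4 ≤ 334) := by
  classical
  have hp0 : 0 < p := hp.pos
  have hpodd : p % 2 = 1 := (Nat.Prime.eq_one_or_self_of_dvd hp 2 |> fun h => by
    rcases Nat.even_or_odd p with he | ho
    · exfalso; obtain ⟨c, hc⟩ := he; have := h ⟨c, by omega⟩; omega
    · exact Nat.odd_iff.mp ho)
  obtain ⟨hSd, hSo, hSs, hS1, hSS⟩ := seidel_identities_of_conferenceGraph A h01 hsymm hdiag 83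
    (by rw [hV]; norm_num) (fun x => by rw [hk x]; norm_num) hsrg
  set S : V → V → ℤ := fun x y => 1 - (if x = y then 1 else 0) - 2 * A x y with hS_def
  have hSS' : ∀ x y, ∑ z, S x z * S z y = 333 * (if x = y then 1 else 0) - 1 := fun x y => by
    rw [hSS x y, hV]; norm_num
  have hSσ : ∀ x y, S (σ x) (σ y) = S x y := fun x y => by
    simp only [hS_def, hA, σ.injective.eq_iff]
  have hSσk : ∀ (k : ℕ) x y, S ((σ ^ k) x) ((σ ^ k) y) = S x y := by
    intro k; induction k with
    | zero => intro x y; simp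
    | succ k ih => intro x y; rw [pow_succ', Equiv.Perm.mul_apply, Equiv.Perm.mul_apply, hSσ, ih]
  have hSd' : ∀ x, S x x = 0 := fun x => hSd x
  have hSo' : ∀ x y, x ≠ y → S x y = 1 ∨ S x y = -1 := fun x y => hSo x y
  have hSs' : ∀ x y, S y x = S x y := fun x y => hSs x y
  have hSsq : ∀ x y, x ≠ y → S x y * S x y = 1 := fun x y h => by
    rcases hSo' x y h with e | e <;> rw [e] <;> norm_num
  -- orbits
  set orb : V → Finset V := fun x => (Finset.range p).image (fun k => (σ ^ k) x) with horb_def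
  have horb_mem : ∀ x y, y ∈ orb x ↔ orb y = orb x := fun x y => mem_orbP_iff σ hp0 hσ x y
  have horb_σ : ∀ y, orb (σ y) = orb y := fun y => (horb_mem y (σ y)).mp (by
    simp only [horb_def]
    exact Finset.mem_image.mpr ⟨1, Finset.mem_range.mpr hp.one_lt, by simp⟩)
  set ι := {j : Finset V // j ∈ univ.image orb} with hι_def
  set cls : V → ι := fun x => ⟨orb x, Finset.mem_image_of_mem _ (Finset.mem_univ x)⟩ with hcls_def
  have hcls_eq : ∀ x y, cls y = cls x ↔ orb y = orb x := fun x y => by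
    rw [hcls_def, Subtype.mk.injEq]
  have hcls_σ : ∀ y, cls (σ y) = cls y := fun y => (hcls_eq y (σ y)).mpr (horb_σ y)
  have hcell : ∀ x, (univ.filter fun y => cls y = cls x) = orb x := by
    intro x; ext y
    rw [Finset.mem_filter, hcls_eq, ← horb_mem]
    simp
  have hrep : ∀ i : ι, ∃ x, cls x = i := by
    rintro ⟨j, hj⟩
    obtain ⟨x, -, hx⟩ := Finset.mem_image.mp hj
    exact ⟨x, Subtype.ext hx⟩
  choose rep hrep using hrep
  have hcellrep : ∀ i : ι, (univ.filter fun y => cls y = i) = orb (rep i) := fun i => by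
    rw [← hcell (rep i), hrep]
  set R : Matrix ι ι ℤ := fun i j => ∑ y ∈ univ.filter (fun y => cls y = j), S (rep i) y with hR_def
  have hshift : ∀ r (j : ι), ∑ y ∈ univ.filter (fun y => cls y = j), S (σ r) y =
      ∑ y ∈ univ.filter (fun y => cls y = j), S r y := by
    intro r j
    rw [Finset.sum_filter, Finset.sum_filter]
    exact Fintype.sum_equiv σ.symm _ _ fun y => by
      rw [show cls y = cls (σ (σ.symm y)) by rw [Equiv.apply_symm_apply], hcls_σ,
        show S (σ r) y = S (σ r) (σ (σ.symm y)) by rw [Equiv.apply_symm_apply], hSσ]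
  have hshiftk : ∀ (k : ℕ) r (j : ι), ∑ y ∈ univ.filter (fun y => cls y = j), S ((σ ^ k) r) y =
      ∑ y ∈ univ.filter (fun y => cls y = j), S r y := by
    intro k; induction k with
    | zero => intro r j; simp
    | succ k ih => intro r j; rw [pow_succ', Equiv.Perm.mul_apply, hshift, ih]
  have hR : ∀ x j, ∑ y ∈ univ.filter (fun y => cls y = j), S x y = R (cls x) j := by
    intro x j
    have hx : x ∈ orb (rep (cls x)) := by rw [horb_mem, ← hcls_eq, hrep]
    obtain ⟨k, -, hkx⟩ := Finset.mem_image.mp hx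
    rw [hR_def]; simp only
    conv_lhs => rw [← hkx]
    exact hshiftk k _ j
  have hids := fun i k => seidel333_classSum_identities S hSs hS1 hSS' cls R hR i k (rep i) (hrep i)
  have htr : ∑ i, R i i = 0 := by
    refine classSum_trace_zero R 333 not_isSquare_333_sp (fun k => ((univ.filter fun y => cls y = k).card : ℤ))
      (fun i => (hids i i).1) fun i k => ?_
    rw [(hids i k).2.1]
    push_cast
    ring
  -- orbit sizes
  have horb_fix : ∀ i, σ (rep i) = rep i → orb (rep i) = {rep i} := by
    intro i hfix
    simp only [horb_def]; ext y
    simp only [Finset.mem_image, Finset.mem_range, Finset.mem_singleton]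
    constructor
    · rintro ⟨k, -, rfl⟩; exact Equiv.Perm.pow_apply_eq_self_of_apply_eq_self hfix k
    · rintro rfl; exact ⟨0, hp0, by simp⟩
  have horb_card : ∀ i, (orb (rep i)).card = if σ (rep i) = rep i then 1 else p := by
    intro i
    split_ifs with hfix
    · rw [horb_fix i hfix, Finset.card_singleton]
    · simp only [horb_def]
      rw [Finset.card_image_of_injOn (orbP_injOn σ hp hσ (rep i) hfix), Finset.card_range]
  have hn : ∀ i, ((univ.filter fun y => cls y = i).card : ℤ) = if σ (rep i) = rep i then 1 else (p : ℤ) := by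
    intro i; rw [hcellrep, horb_card]; split_ifs <;> simp
  -- diagonal entries and half sums
  set h := (p + 1) / 2 with hh_def
  have hh : h + h = p + 1 := by omega
  set u : ι → ℤ := fun i => ∑ k ∈ Finset.Ico 1 h, S (rep i) ((σ ^ k) (rep i)) with hu_def
  have hdiagR : ∀ i, R i i = if σ (rep i) = rep i then 0 else 2 * u i := by
    intro i
    have h0 : R i i = ∑ y ∈ orb (rep i), S (rep i) y := by
      rw [hR_def]; simp only; rw [hcellrep]
    rw [h0]
    split_ifs with hfix
    · rw [horb_fix i hfix, Finset.sum_singleton, hSd']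
    · simp only [horb_def]
      rw [Finset.sum_image (orbP_injOn σ hp hσ (rep i) hfix), Finset.range_eq_Ico,
        ← Finset.sum_Ico_consecutive _ (by omega : 0 ≤ 1) (by omega : 1 ≤ p), Finset.sum_Ico_succ_top (by rfl),
        Finset.Ico_self, Finset.sum_empty, zero_add, pow_zero, Equiv.Perm.one_apply, hSd', zero_add,
        ← Finset.sum_Ico_consecutive _ (by omega : 1 ≤ h) (by omega : h ≤ p),
        sum_Ico_reflect_odd (fun k => S (rep i) ((σ ^ k) (rep i))) hh (fun k hk0 hkp => ?_), hu_def]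
      · ring
      · show S (rep i) ((σ ^ (p - k)) (rep i)) = S (rep i) ((σ ^ k) (rep i))
        rw [← hSσk k (rep i) ((σ ^ (p - k)) (rep i)), ← Equiv.Perm.mul_apply, ← pow_add,
          Nat.add_sub_cancel' hkp.le, hσ, Equiv.Perm.one_apply, hSs']
  -- u i is odd when p % 4 = 3
  have hu_odd : p % 4 = 3 → ∀ i, σ (rep i) ≠ rep i → ((u i : ℤ) : ZMod 2) = 1 := by
    intro hp4 i hfix
    rw [hu_def]; simp only
    rw [Int.cast_sum]
    have hterm : ∀ k ∈ Finset.Ico 1 h, ((S (rep i) ((σ ^ k) (rep i)) : ℤ) : ZMod 2) = 1 := by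
      intro k hk
      rw [Finset.mem_Ico] at hk
      have hne : rep i ≠ (σ ^ k) (rep i) := by
        intro e
        have := orbP_injOn σ hp hσ (rep i) hfix (show k ∈ (Finset.range p : Set ℕ) by simp; omega)
          (show 0 ∈ (Finset.range p : Set ℕ) by simp; omega) (by simp [← e])
        omega
      rcases hSo' _ _ hne with e | e <;> rw [e] <;> decide
    rw [Finset.sum_congr rfl hterm, Finset.sum_const, Nat.card_Ico, nsmul_eq_mul, mul_one]
    have : h - 1 = 2 * ((h - 1) / 2) + 1 := by omega
    rw [this]; push_cast
    rw [show (2 : ZMod 2) = 0 from rfl]; ring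
  -- T = p-orbits; f and m
  set T := (univ : Finset ι).filter (fun i => σ (rep i) ≠ rep i) with hT_def
  have h333 : (333 : ℕ) = ∑ i : ι, (orb (rep i)).card := by
    rw [← hV, ← Finset.card_univ, Finset.card_eq_sum_card_fiberwise (f := cls) (t := univ)
      fun _ _ => Finset.mem_univ _]
    exact Finset.sum_congr rfl fun i _ => by rw [hcellrep]
  have hf : (univ.filter fun x => σ x = x).card = ∑ i : ι, ((orb (rep i)).filter fun y => σ y = y).card := by
    rw [Finset.card_eq_sum_card_fiberwise (f := cls) (s := univ.filter fun x => σ x = x) (t := univ)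
      fun _ _ => Finset.mem_univ _]
    refine Finset.sum_congr rfl fun i _ => congrArg Finset.card ?_
    ext y
    rw [Finset.mem_filter, Finset.mem_filter, Finset.mem_filter, ← hcellrep i, Finset.mem_filter]
    tauto
  have horb_fixed : ∀ i, ((orb (rep i)).filter fun y => σ y = y).card = if σ (rep i) = rep i then 1 else 0 := by
    intro i
    split_ifs with hfix
    · rw [horb_fix i hfix, Finset.filter_singleton, if_pos hfix, Finset.card_singleton]
    · rw [Finset.card_eq_zero, Finset.filter_eq_empty_iff]
      intro y hy
      simp only [horb_def] at hy
      obtain ⟨k, -, rfl⟩ := Finset.mem_image.mp hy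
      intro e
      rw [← perm_pow_apply_comm] at e
      exact hfix ((σ ^ k).injective e)
  rw [Finset.sum_congr rfl fun i _ => horb_card i, Finset.sum_ite, Finset.sum_const, Finset.sum_const] at h333
  rw [Finset.sum_congr rfl fun i _ => horb_fixed i, Finset.sum_ite, Finset.sum_const, Finset.sum_const] at hf
  simp only [smul_eq_mul, mul_one, mul_zero, add_zero] at h333 hf
  have hTc : (univ.filter fun i : ι => ¬ σ (rep i) = rep i).card = T.card := by rw [hT_def]
  rw [hTc] at h333
  set fN := (univ.filter fun i : ι => σ (rep i) = rep i).card with hfN_def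
  -- a p-orbit exists
  obtain ⟨x₀, hx₀⟩ : ∃ x, σ x ≠ x := not_forall.mp fun hall => hσ1 (Equiv.ext hall)
  set i₀ := cls x₀ with hi₀_def
  have hi₀ : σ (rep i₀) ≠ rep i₀ := by
    intro hfix
    have hx : x₀ ∈ orb (rep i₀) := by rw [horb_mem, ← hcls_eq, hrep]
    rw [horb_fix i₀ hfix, Finset.mem_singleton] at hx
    exact hx₀ (by rw [hx, hfix])
  have hi₀T : i₀ ∈ T := Finset.mem_filter.mpr ⟨Finset.mem_univ _, hi₀⟩
  have hm1 : 1 ≤ T.card := Finset.card_pos.mpr ⟨i₀, hi₀T⟩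
  -- the row identity at i₀ with weights
  have hrow : ∑ j, R i₀ j * R j i₀ = 333 - p := by
    rw [(hids i₀ i₀).2.1, if_pos rfl, mul_one, hn, if_neg hi₀]
  have hwt : ∀ j, R i₀ j * R j i₀ = (if σ (rep j) = rep j then (p : ℤ) else 1) * (R i₀ j * R i₀ j) := by
    intro j
    have e := (hids i₀ j).2.2
    rw [hn, hn, if_neg hi₀] at e
    by_cases hfix : σ (rep j) = rep j
    · rw [if_pos hfix, one_mul] at e
      rw [if_pos hfix, ← e]; ring
    · rw [if_neg hfix] at e
      have hpz : (p : ℤ) ≠ 0 := by exact_mod_cast hp.ne_zero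
      rw [if_neg hfix, ← mul_right_injective₀ hpz e]; ring
  -- lower bounds for the squares
  have hsq_fixed : ∀ j, σ (rep j) = rep j → R i₀ j * R i₀ j = 1 := by
    intro j hfix
    have e : R i₀ j = S (rep i₀) (rep j) := by
      rw [hR_def]; simp only; rw [hcellrep, horb_fix j hfix, Finset.sum_singleton]
    rw [e]
    refine hSsq _ _ fun h => hi₀ ?_
    rw [h]; exact hfix
  have hsq_other : ∀ j, σ (rep j) ≠ rep j → j ≠ i₀ → 1 ≤ R i₀ j * R i₀ j := by
    intro j hfix hne
    have hodd : ((R i₀ j : ℤ) : ZMod 2) = 1 := by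
      rw [hR_def]; simp only; rw [hcellrep]; simp only [horb_def]
      rw [Finset.sum_image (orbP_injOn σ hp hσ (rep j) hfix), Int.cast_sum]
      have hterm : ∀ k ∈ Finset.range p, ((S (rep i₀) ((σ ^ k) (rep j)) : ℤ) : ZMod 2) = 1 := by
        intro k hk
        have hne' : rep i₀ ≠ (σ ^ k) (rep j) := by
          intro e
          apply hne
          have hmem : rep i₀ ∈ orb (rep j) := by
            simp only [horb_def]; exact Finset.mem_image.mpr ⟨k, hk, e.symm⟩
          rw [horb_mem] at hmem
          have := (hcls_eq (rep j) (rep i₀)).mpr hmem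
          rw [hrep, hrep] at this
          exact this.symm
        rcases hSo' _ _ hne' with e | e <;> rw [e] <;> decide
      rw [Finset.sum_congr rfl hterm, Finset.sum_const, Finset.card_range, nsmul_eq_mul, mul_one]
      rw [show p = 2 * (p / 2) + 1 by omega]; push_cast
      rw [show (2 : ZMod 2) = 0 from rfl]; ring
    have hne0 : R i₀ j ≠ 0 := by
      intro h0; rw [h0, Int.cast_zero] at hodd; exact zero_ne_one hodd
    have := mul_self_pos.mpr hne0
    linarith
  have hsq_self : 0 ≤ R i₀ i₀ * R i₀ i₀ := mul_self_nonneg _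
  have hsq_self4 : p % 4 = 3 → 4 ≤ R i₀ i₀ * R i₀ i₀ := by
    intro hp4
    rw [hdiagR, if_neg hi₀]
    have hu1 := hu_odd hp4 i₀ hi₀
    have hune : u i₀ ≠ 0 := by intro h0; rw [h0, Int.cast_zero] at hu1; exact zero_ne_one hu1
    have := mul_self_pos.mpr hune
    nlinarith
  -- summing the bounds
  have hsum_ge : ∀ b : ℤ, b ≤ R i₀ i₀ * R i₀ i₀ →
      (p : ℤ) * fN + T.card + (b - 1) ≤ ∑ j, R i₀ j * R j i₀ := by
    intro b hb
    have hpt : ∀ j ∈ (univ : Finset ι),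
        (if σ (rep j) = rep j then (p : ℤ) else 1) + (if j = i₀ then b - 1 else 0) ≤ R i₀ j * R j i₀ := by
      intro j _
      rw [hwt j]
      by_cases hfix : σ (rep j) = rep j
      · have hji : j ≠ i₀ := fun h => hi₀ (h ▸ hfix)
        rw [if_pos hfix, if_neg hji, hsq_fixed j hfix]; simp
      · rw [if_neg hfix]
        by_cases hji : j = i₀
        · rw [if_pos hji, hji, one_mul]; linarith
        · rw [if_neg hji, one_mul, add_zero]; exact hsq_other j hfix hji
    refine le_trans (le_of_eq ?_) (Finset.sum_le_sum hpt)
    rw [Finset.sum_add_distrib, Finset.sum_ite, Finset.sum_const, Finset.sum_const, Finset.sum_ite_eq' univ i₀,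
      if_pos (Finset.mem_univ _), hTc, ← hfN_def]
    simp only [nsmul_eq_mul, mul_one]
    ring
  have hTeven : p % 4 = 3 → 2 ∣ T.card := by
    intro hp4
    have hsumT : ∑ i ∈ T, u i = 0 := by
      have e := htr
      rw [Finset.sum_congr rfl fun i _ => hdiagR i, Finset.sum_ite, Finset.sum_const_zero, zero_add,
        ← Finset.mul_sum] at e
      have e' : ∑ i ∈ univ.filter (fun i => ¬ σ (rep i) = rep i), u i = 0 := by linarith
      rw [hT_def]; convert e' using 2
    have hcast : ((∑ i ∈ T, u i : ℤ) : ZMod 2) = (T.card : ZMod 2) := by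
      rw [Int.cast_sum, Finset.card_eq_sum_ones, Nat.cast_sum]
      refine Finset.sum_congr rfl fun i hi => ?_
      rw [Nat.cast_one]
      exact hu_odd hp4 i (fun e => (Finset.mem_filter.mp hi).2 e)
    rw [hsumT, Int.cast_zero] at hcast
    exact (ZMod.natCast_eq_zero_iff _ 2).mp hcast.symm
  refine ⟨fN, T.card, hf, by rw [h333]; ring, hm1, ?_, fun hp4 => ⟨hTeven hp4, ?_⟩⟩
  · have := hsum_ge 0 hsq_self
    rw [hrow] at this
    have h' : (p : ℤ) * fN + T.card + p ≤ 334 := by linarith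
    exact_mod_cast h'
  · have := hsum_ge 4 (hsq_self4 hp4)
    rw [hrow] at this
    have h' : (p : ℤ) * fN + T.card + p + 4 ≤ 334 := by linarith
    exact_mod_cast h'

/-- **Prime-order spectrum.**  If an `srg(333,166,82,83)` has a non-identity automorphism `σ` with `σ^p = 1`, `p`
prime, then `p ∈ {2, 3, 5, 7, 11, 13, 17, 23, 37, 41, 83}`.  (All other primes are excluded by `f + pm = 333`,
`m ≥ 1`, the row bound, and — for `p ≡ 3 (mod 4)` — the evenness of `m`: e.g. `19` (`f ≡ 29 (38)` vs `f ≤ 15`), `29`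
(`f ≡ 14 (29)` vs `f ≤ 10`), `31`, `43`, `47`, `53`, ….) -/
theorem aut_prime_spectrum (hV : Fintype.card V = 333) (A : Matrix V V ℤ)
    (h01 : ∀ x y, A x y = 0 ∨ A x y = 1) (hsymm : ∀ x y, A y x = A x y) (hdiag : ∀ x, A x x = 0)
    (hk : ∀ x, ∑ y, A x y = 166) (hsrg : ∀ x y, ∑ z, A x z * A z y = 83 * (1 + (if x = y then 1 else 0)) - A x y)
    {p : ℕ} (hp : p.Prime) (σ : Equiv.Perm V) (hσ : σ ^ p = 1) (hσ1 : σ ≠ 1)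
    (hA : ∀ x y, A (σ x) (σ y) = A x y) :
    p = 2 ∨ p = 3 ∨ p = 5 ∨ p = 7 ∨ p = 11 ∨ p = 13 ∨ p = 17 ∨ p = 23 ∨ p = 37 ∨ p = 41 ∨ p = 83 := by
  by_cases hp2 : p = 2
  · exact Or.inl hp2
  obtain ⟨f, m, -, hfm, hm1, hb, hpar⟩ := primeOrder_census hV A h01 hsymm hdiag hk hsrg hp hp2 σ hσ hσ1 hA
  have hple : p ≤ 333 := by nlinarith
  interval_cases p <;>
    first
      | omega
      | (exfalso; norm_num at hp)

/-- **Fixed-point windows** for the surviving odd primes: `(p, f)` with `f` the number of fixed points of a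
non-identity automorphism `σ`, `σ^p = 1`:  `p = 3: f ≡ 3 (6), f ≤ 81` · `5: f ≡ 3 (5), f ≤ 53` · `7: f ∈ {11,25,39}` ·
`11: f ∈ {3,25}` · `13: f ∈ {8,21}` · `17: f = 10` · `23: f = 11` · `37: f = 0` · `41: f = 5` · `83: f = 1`. -/
theorem aut_prime_windows (hV : Fintype.card V = 333) (A : Matrix V V ℤ)
    (h01 : ∀ x y, A x y = 0 ∨ A x y = 1) (hsymm : ∀ x y, A y x = A x y) (hdiag : ∀ x, A x x = 0)
    (hk : ∀ x, ∑ y, A x y = 166) (hsrg : ∀ x y, ∑ z, A x z * A z y = 83 * (1 + (if x = y then 1 else 0)) - A x y)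
    {p : ℕ} (hp : p.Prime) (hp2 : p ≠ 2) (σ : Equiv.Perm V) (hσ : σ ^ p = 1) (hσ1 : σ ≠ 1)
    (hA : ∀ x y, A (σ x) (σ y) = A x y) :
    let f := (univ.filter fun x => σ x = x).card
    (p = 3 → f % 6 = 3 ∧ f ≤ 81) ∧ (p = 5 → f % 5 = 3 ∧ f ≤ 53) ∧ (p = 7 → f = 11 ∨ f = 25 ∨ f = 39) ∧
    (p = 11 → f = 3 ∨ f = 25) ∧ (p = 13 → f = 8 ∨ f = 21) ∧ (p = 17 → f = 10) ∧ (p = 23 → f = 11) ∧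
    (p = 37 → f = 0) ∧ (p = 41 → f = 5) ∧ (p = 83 → f = 1) := by
  intro f
  obtain ⟨f', m, hff', hfm, hm1, hb, hpar⟩ := primeOrder_census hV A h01 hsymm hdiag hk hsrg hp hp2 σ hσ hσ1 hA
  have hf : f = f' := hff'
  refine ⟨?_, ?_, ?_, ?_, ?_, ?_, ?_, ?_, ?_, ?_⟩ <;> intro hpv <;> subst hpv
  · obtain ⟨⟨c, hc⟩, hb'⟩ := hpar (by norm_num); omega
  · omega
  · obtain ⟨⟨c, hc⟩, hb'⟩ := hpar (by norm_num); omega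
  · obtain ⟨⟨c, hc⟩, hb'⟩ := hpar (by norm_num); omega
  · omega
  · omega
  · obtain ⟨⟨c, hc⟩, hb'⟩ := hpar (by norm_num); omega
  · omega
  · omega
  · obtain ⟨⟨c, hc⟩, hb'⟩ := hpar (by norm_num); omega

end spectrum

end Summit.Ventures.DiscreteObjects.Hadamard
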